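import Summits.CriticalPhenomena.Ising3DConformalLimit.Theorems.HyperoctahedralRPExistsScaleCovariantLimitDecimationMeshRateGivesCrux
import Summits.CriticalPhenomena.Ising3DConformalLimit.Theorems.HyperoctahedralRPExistsScaleCovariantLimitBlockLimitsGiveCrux
import HarnessLib

/-!
# The funnel through item 6150 — crux `ExistsScaleCovariantLimit` (item stmt-CriticalPhenomena-1981), lead c9

Route `HyperoctahedralRP` (sub-problem `CriticalPhenomena/Ising3DConformalLimit`); crux
`Summit.CriticalPhenomena.Ising3DConformalLimit.Theses.HyperoctahedralRP.ExistsScaleCovariantLimit` (shared verbatim by 14 routes).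
Pure composition of LANDED theorems, recorded in one importable place for planners and refuters (registered sub-goal
`funnel_through_doubling` of the line lead c9, `--supports stmt-CriticalPhenomena-1981`):

**every known road to the crux, and the crux itself, passes through the open item 6150 `TwoPointDoubling`**
(`∃ κ > 0, ∀ n ≥ 1, κ·⟨σ₀σ_{ne₀}⟩_{β_c} ≤ ⟨σ₀σ_{2ne₀}⟩_{β_c}`, all-scale axis doubling of the critical nearest-neighbour two-point
function on `ℤ³`; explicitly open: Aizenman–Duminil-Copin 2021, Remark 5.10 and §5.6):

* the crux ⟹ 6150 (`twoPointDoubling_of_crux`: crux ⟺ item 6153 `PointwiseLimit`, p123864, and 6153 ⟹ 6150);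
* item 6153 ⟹ 6150, item 14454 `ZoomMonotone` ⟹ 6150, item 5955 `OrbitPrecompact` ⟺ 6150 ⟺ item 4658 `UniformRegularity` (p120504);
* the engine of line `decimation-homotopy-rate` ⟹ 6150 (`PathLipschitz 2`, p130196; already its consumed minimum, the dyadic mesh
  rate, p130473);
* the engine of line `monotone-blocking-port` ⟹ 6150 (`BM₂ = Sig.stub_monotoneBlockingTwo`, and already `BlockTwoLimits`, p128428).

Contrapositive (`all_fail_of_not_twoPointDoubling`): a refutation of item 6150 refutes at once the crux (hence the cruxes of all 14
routes sharing it), items 6153, 14454, 5955, 4658, and both live engines PL₂ and BM₂. Conversely nothing here claims 6150 suffices: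
it is the compactness half only (`orbitPrecompact_iff_doubling`); the uniqueness half is the residue S2' ∧ S3' ⟺ crux (p123864).

References: M. Aizenman, H. Duminil-Copin, Ann. of Math. 194 (2021), arXiv:1912.07973, Remark 5.10, Def. 5.11, Thm 5.12 (p. 20);
H. Duminil-Copin, ICM 2022, §8.4 p. 29.
-/

namespace Summit.CriticalPhenomena.Ising3DConformalLimit.Cruxes.ExistsScaleCovariantLimit.Funnel

open Literature.Probability.LatticeModels
open Summit.CriticalPhenomena.Ising3DConformalLimit.Theses

/-- **The crux ⟹ item 6150**: existence of the scale-covariant full scaling limit of the critical `ℤ³` correlators forces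
all-scale axis doubling of the critical two-point function (crux ⟺ item 6153, and 6153 ⟹ 6150, both landed).
[cite: AizenmanDuminilCopinAnnals2021, arXiv:1912.07973 Remark 5.10] -/
theorem twoPointDoubling_of_crux (h : HyperoctahedralRP.ExistsScaleCovariantLimit) :
    MirrorHoelderCompactness.TwoPointDoubling :=
  TwoHierarchies.twoPointDoubling_of_pointwiseLimit (TwoHierarchies.crux_iff_pointwiseLimit.1 h)

/-- **THE FUNNEL (registered sub-goal).** Every known road to the crux, and the crux itself, implies item 6150
`TwoPointDoubling`: the crux; item 6153 `PointwiseLimit`; item 14454 `ZoomMonotone`; item 5955 `OrbitPrecompact`; item 4658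
`UniformRegularity`; the engine `PathLipschitz 2` of line `decimation-homotopy-rate` and its consumed minimum, the dyadic mesh rate (inlined); the
engine `BM₂` of line `monotone-blocking-port` and its consumed minimum `BlockTwoLimits`. Pure composition of landed theorems
(p123864, p120504, p122713, p130196, p130473, p128428). [cite: AizenmanDuminilCopinAnnals2021, arXiv:1912.07973 Remark 5.10 and §5.6 p. 20] -/
theorem funnel_through_doubling :
    (HyperoctahedralRP.ExistsScaleCovariantLimit → MirrorHoelderCompactness.TwoPointDoubling) ∧
    (MirrorHoelderCompactness.PointwiseLimit → MirrorHoelderCompactness.TwoPointDoubling) ∧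
    (MonotoneRG.ZoomMonotone → MirrorHoelderCompactness.TwoPointDoubling) ∧
    (MonotoneRG.OrbitPrecompact → MirrorHoelderCompactness.TwoPointDoubling) ∧
    (MonotoneRG.UniformRegularity → MirrorHoelderCompactness.TwoPointDoubling) ∧
    (DecimationHomotopyRate.Sig.stub_pathLipschitz2 → MirrorHoelderCompactness.TwoPointDoubling) ∧
    ((∀ (n : ℕ) (z : Fin n → Site 3), Function.Injective z → ∃ θ : ℝ, 0 < θ ∧ ∃ B : ℝ, ∀ L : ℕ, 1 ≤ L →
      |DecimationHomotopyRate.latticeZoom n (2 * L) z - DecimationHomotopyRate.latticeZoom n L z| ≤ B * (L : ℝ) ^ (-θ)) →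
      MirrorHoelderCompactness.TwoPointDoubling) ∧
    (MonotoneBlockingPort.Sig.stub_monotoneBlockingTwo → MirrorHoelderCompactness.TwoPointDoubling) ∧
    (MonotoneBlockingPort.BlockTwoLimits → MirrorHoelderCompactness.TwoPointDoubling) :=
  ⟨twoPointDoubling_of_crux,
   TwoHierarchies.twoPointDoubling_of_pointwiseLimit,
   TwoHierarchies.twoPointDoubling_of_zoomMonotone,
   TwoHierarchies.ItemMaps.orbitPrecompact_iff_doubling.1,
   TwoHierarchies.ItemMaps.uniformRegularity_iff_doubling.1,
   DecimationHomotopyRate.twoPointDoubling_of_pathLipschitz2,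
   DecimationHomotopyRate.twoPointDoubling_of_meshRate2,
   MonotoneBlockingPort.twoPointDoubling_of_monotoneBlockingTwo,
   MonotoneBlockingPort.twoPointDoubling_of_blockTwoLimits⟩

/-- **Contrapositive**: a refutation of item 6150 `TwoPointDoubling` refutes at once the crux, items 6153, 14454, 5955, 4658, and both
live engines (`PathLipschitz 2`, `BM₂`) together with their consumed minima. [cite: AizenmanDuminilCopinAnnals2021, arXiv:1912.07973 Remark 5.10] -/
theorem all_fail_of_not_twoPointDoubling (h : ¬ MirrorHoelderCompactness.TwoPointDoubling) :
    ¬ HyperoctahedralRP.ExistsScaleCovariantLimit ∧ ¬ MirrorHoelderCompactness.PointwiseLimit ∧ ¬ MonotoneRG.ZoomMonotone ∧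
    ¬ MonotoneRG.OrbitPrecompact ∧ ¬ MonotoneRG.UniformRegularity ∧
    ¬ DecimationHomotopyRate.Sig.stub_pathLipschitz2 ∧
    ¬ (∀ (n : ℕ) (z : Fin n → Site 3), Function.Injective z → ∃ θ : ℝ, 0 < θ ∧ ∃ B : ℝ, ∀ L : ℕ, 1 ≤ L →
      |DecimationHomotopyRate.latticeZoom n (2 * L) z - DecimationHomotopyRate.latticeZoom n L z| ≤ B * (L : ℝ) ^ (-θ)) ∧
    ¬ MonotoneBlockingPort.Sig.stub_monotoneBlockingTwo ∧ ¬ MonotoneBlockingPort.BlockTwoLimits := by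
  obtain ⟨h1, h2, h3, h4, h5, h6, h7, h8, h9⟩ := funnel_through_doubling
  exact ⟨fun h' => h (h1 h'), fun h' => h (h2 h'), fun h' => h (h3 h'), fun h' => h (h4 h'), fun h' => h (h5 h'),
    fun h' => h (h6 h'), fun h' => h (h7 h'), fun h' => h (h8 h'), fun h' => h (h9 h')⟩

/-- The two halves side by side: item 6150 is EXACTLY the compactness half of the crux (⟺ 5955 ⟺ 4658), and the crux is 6150 plus
the uniqueness residue S2' ∧ S3' of the dead line `Sketch` (which alone is already ⟺ the crux, p123864): `crux ⟺ 6150 ∧ 6153`.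
[cite: DuminilCopinICM2022, §8.4 p. 29] -/
theorem crux_iff_doubling_and_pointwiseLimit :
    HyperoctahedralRP.ExistsScaleCovariantLimit ↔
      MirrorHoelderCompactness.TwoPointDoubling ∧ MirrorHoelderCompactness.PointwiseLimit :=
  ⟨fun h => ⟨twoPointDoubling_of_crux h, TwoHierarchies.crux_iff_pointwiseLimit.1 h⟩,
   fun h => TwoHierarchies.crux_iff_pointwiseLimit.2 h.2⟩

end Summit.CriticalPhenomena.Ising3DConformalLimit.Cruxes.ExistsScaleCovariantLimit.Funnel
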